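import Mathlib.NumberTheory.LSeries.Basic
import Mathlib.Data.Nat.Squarefree
import Mathlib.NumberTheory.LegendreSymbol.JacobiSymbol
import HarnessLib

set_option autoImplicit false

/-!
# Crux `PrintCFram.BottomClassIndexLawFiveLe` (stmt-BirchSwinnertonDyer-20372), line `eisenstein-resource-bdp-line` (registry v24):
# (E2) OF THE CUSP-CONJUNCT ASSEMBLY, PART 1 — RE-INDEXING THE (3,0)-`m`-CUT ALONG `a = m · N · f²`
# (cell `bsd-print-cfram`, width seat `bsd-line-cfram-p1-w5` g6; THEOREMS ONLY, `--supports` 20372; BSD is not proved by any of this)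

HONEST FRAMING. Elementary number theory + `tsum` bookkeeping; nothing modular. Ingredient (E2) of the proof plan for the cusp
conjunct «`G = 0 ⟹ ι C = 0`» of the registered stub `stub_cuspCutForm` (= `hcut` of `CuspSeed.cuspSeed_six_of_cutForm`, p688228;
plan: crux notes `Lines/eisenstein-resource-bdp-line-w5g5-cusp-seed.md` §1 «PARAMETRISATION», §5, §15). The (3,0)-`m`-cut of
that stub is the set of indices `a` with `m ∣ a`, `a/m ≡ 3 (mod 4)`, `J(−a/m | q) = 1` for the odd primes `q ∣ m`, `a/m ≡ 7 (mod 8)`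
if `2 ∣ m`, `3 ∤ a/m` (spelled VERBATIM as there). Writing `a/m = N f²` with `N` squarefree:

* `cut_mul_sq_iff` — the cut clauses on `a = m N f²` ⟺ `N` in the FAMILY (`N` squarefree, `N ≡ 3 (mod 4)`, `N ≡ 7 (mod 8)` if
  `2 ∣ m`, `J(−N|q) = 1` for odd primes `q ∣ m`, `3 ∤ N` — exactly the weight support of w3 g13's family mean (III)) and `f ⊥ 6m`;
* `eq_of_squarefree_mul_sq_eq` — uniqueness of `n = N f²`; `tsum_ite_cut_eq_tsum_prod`, `summable_ite_cut_iff_summable_prod` —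
  `(N, f) ↦ m N f²` is a bijection {family} × {f ⊥ 6m} → cut, so sums over the cut re-index (unconditionally) and summability
  transfers;
* the companion file `…CuspSeedCutUnfolding.lean` applies this to Cohen's `H(k, ·)` (`CuspSeed.LSeries_ite_cut_cohenH_eq`).

Pure elementary number theory (Mathlib `jacobiSym`, `Squarefree`, `tsum`). [folklore]
References: [MontgomeryVaughan2007] Thm. 9.13 (Kronecker/Jacobi symbols); [IrelandRosen1982] Ch. 5 §2 (Jacobi symbol).
-/

-- summit-side namespace `Summit.BirchSwinnertonDyer.BirchSwinnertonDyer.…` (single-conjunct summit, D-0017 layout)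
set_option linter.dupNamespace false

namespace Summit.BirchSwinnertonDyer.BirchSwinnertonDyer.Theorems.PrintCFram.CuspSeed

open scoped NumberTheorySymbols Classical

/-! ## §1 Uniqueness of the decomposition `n = N · f²`, `N` squarefree -/

/-- If `N f² = N' f'²` with `N, N'` squarefree and `f, f' ≥ 1`, then `N = N'` and `f = f'` (compare prime factorisations:
`v_p(N) = v_p(n) mod 2`, `v_p(f) = ⌊v_p(n)/2⌋`). [folklore] -/
theorem eq_of_squarefree_mul_sq_eq {N N' f f' : ℕ} (hN : Squarefree N) (hN' : Squarefree N') (hf : f ≠ 0) (hf' : f' ≠ 0)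
    (h : N * f ^ 2 = N' * f' ^ 2) : N = N' ∧ f = f' := by
  have hN0 : N ≠ 0 := hN.ne_zero
  have hN'0 : N' ≠ 0 := hN'.ne_zero
  have h1 := (Nat.squarefree_iff_factorization_le_one hN0).mp hN
  have h1' := (Nat.squarefree_iff_factorization_le_one hN'0).mp hN'
  have hfac : ∀ p : ℕ, N.factorization p + 2 * f.factorization p = N'.factorization p + 2 * f'.factorization p := by
    intro p
    have := congrArg (fun n : ℕ ↦ n.factorization p) h
    simpa only [Nat.factorization_mul hN0 (pow_ne_zero 2 hf), Nat.factorization_mul hN'0 (pow_ne_zero 2 hf'),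
      Nat.factorization_pow, Finsupp.add_apply, Finsupp.smul_apply, smul_eq_mul] using this
  have hNN' : ∀ p : ℕ, N.factorization p = N'.factorization p := by
    intro p
    have := hfac p
    have := h1 p
    have := h1' p
    omega
  have hff' : ∀ p : ℕ, f.factorization p = f'.factorization p := by
    intro p
    have := hfac p
    have := hNN' p
    omega
  exact ⟨Nat.eq_of_factorization_eq hN0 hN'0 hNN', Nat.eq_of_factorization_eq hf hf' hff'⟩

/-! ## §2 The cut clauses along `n' = N · f²` -/

/-- An odd square is `≡ 1 (mod 8)`, so `N f² ≡ N (mod 8)` for odd `f`. [folklore] -/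
theorem mul_sq_mod_eight_of_odd (N : ℕ) {f : ℕ} (hf : Odd f) : N * f ^ 2 % 8 = N % 8 := by
  obtain ⟨j, rfl⟩ := hf
  have h8 : (2 * j + 1) ^ 2 % 8 = 1 := by
    have : (2 * j + 1) ^ 2 = 4 * (j * (j + 1)) + 1 := by ring
    rw [this]
    obtain ⟨i, hi⟩ := Nat.even_mul_succ_self j
    rw [hi]
    omega
  rw [Nat.mul_mod, h8, mul_one, Nat.mod_mod]

/-- `N f² ≡ N (mod 4)` for odd `f`. [folklore] -/
theorem mul_sq_mod_four_of_odd (N : ℕ) {f : ℕ} (hf : Odd f) : N * f ^ 2 % 4 = N % 4 := by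
  have h := mul_sq_mod_eight_of_odd N hf
  omega

/-- If `N f² ≡ 3 (mod 4)` then `f` is odd. [folklore] -/
theorem odd_of_mul_sq_mod_four {N f : ℕ} (h : N * f ^ 2 % 4 = 3) : Odd f := by
  rcases Nat.even_or_odd f with ⟨j, rfl⟩ | hf
  · exfalso
    have : N * (j + j) ^ 2 = 4 * (N * j ^ 2) := by ring
    rw [this] at h
    omega
  · exact hf

/-- For an odd prime `q`: `J(−N f² | q) = 1 ↔ J(−N | q) = 1 ∧ q ∤ f`. [folklore] -/
theorem jacobiSym_neg_mul_sq_eq_one_iff {q : ℕ} (hq : q.Prime) (N f : ℕ) :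
    J(-((N * f ^ 2 : ℕ) : ℤ) | q) = 1 ↔ J(-(N : ℤ) | q) = 1 ∧ ¬ q ∣ f := by
  haveI := Fact.mk hq
  have hmul : J(-((N * f ^ 2 : ℕ) : ℤ) | q) = J(-(N : ℤ) | q) * J((f : ℤ) | q) ^ 2 := by
    rw [show (-((N * f ^ 2 : ℕ) : ℤ)) = (-(N : ℤ)) * ((f : ℤ) * (f : ℤ)) by push_cast; ring, jacobiSym.mul_left,
      jacobiSym.mul_left, sq]
  rw [hmul]
  by_cases hqf : q ∣ f
  · have h0 : J((f : ℤ) | q) = 0 := by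
      rw [jacobiSym.eq_zero_iff]
      refine ⟨hq.ne_zero, ?_⟩
      rw [Int.gcd_natCast_natCast]
      exact fun h1 ↦ hq.one_lt.ne' (by rw [← h1]; exact (Nat.gcd_eq_right hqf).symm)
    rw [h0]
    simp [hqf]
  · have h1 : J((f : ℤ) | q) ^ 2 = 1 := by
      refine jacobiSym.sq_one ?_
      rw [Int.gcd_natCast_natCast]
      exact (Nat.coprime_comm.mp ((Nat.Prime.coprime_iff_not_dvd hq).mpr hqf))
    rw [h1, mul_one]
    simp [hqf]

/-- For `f ⊥ 3`-type clauses: `3 ∤ N f² ↔ 3 ∤ N ∧ 3 ∤ f`. [folklore] -/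
theorem not_three_dvd_mul_sq_iff (N f : ℕ) : ¬ 3 ∣ N * f ^ 2 ↔ ¬ 3 ∣ N ∧ ¬ 3 ∣ f := by
  rw [Nat.Prime.dvd_mul Nat.prime_three]
  constructor
  · intro h
    refine ⟨fun hN ↦ h (Or.inl hN), fun hf ↦ h (Or.inr (dvd_pow hf two_ne_zero))⟩
  · rintro ⟨hN, hf⟩ (h | h)
    · exact hN h
    · exact hf (Nat.prime_three.dvd_of_dvd_pow h)

/-- **The cut clauses along `n' = N f²`.** For `m ≥ 1` and any `N, f`, the index `a = m · (N f²)` satisfies the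
(3,0)-`m`-cut clauses of `stub_cuspCutForm` (`m ∣ a`, `a/m ≡ 3 (mod 4)`, `J(−a/m | q) = 1` for the odd primes `q ∣ m`,
`a/m ≡ 7 (mod 8)` if `2 ∣ m`, `3 ∤ a/m`) iff `N` lies in the family (`N ≡ 3 (mod 4)`, `N ≡ 7 (mod 8)` if `2 ∣ m`, `J(−N|q) = 1` for
the odd primes `q ∣ m`, `3 ∤ N`) and `f ⊥ 6m`. [folklore] -/
theorem cut_mul_sq_iff {m : ℕ} (hm : m ≠ 0) (N f : ℕ) :
    (m ∣ m * (N * f ^ 2) ∧ m * (N * f ^ 2) / m % 4 = 3 ∧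
      (∀ q : ℕ, q.Prime → q ∣ m → q ≠ 2 → J(-((m * (N * f ^ 2) / m : ℕ) : ℤ) | q) = 1) ∧
      (2 ∣ m → m * (N * f ^ 2) / m % 8 = 7) ∧ ¬ 3 ∣ m * (N * f ^ 2) / m) ↔
    ((N % 4 = 3 ∧ (2 ∣ m → N % 8 = 7) ∧ (∀ q : ℕ, q.Prime → q ∣ m → q ≠ 2 → J(-(N : ℤ) | q) = 1) ∧ ¬ 3 ∣ N) ∧
      f.Coprime (6 * m)) := by
  rw [Nat.mul_div_cancel_left _ (Nat.pos_of_ne_zero hm)]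
  constructor
  · rintro ⟨-, h4, hJ, h8, h3⟩
    have hodd : Odd f := odd_of_mul_sq_mod_four h4
    rw [mul_sq_mod_four_of_odd N hodd] at h4
    rw [mul_sq_mod_eight_of_odd N hodd] at h8
    rw [not_three_dvd_mul_sq_iff] at h3
    have hJ' : ∀ q : ℕ, q.Prime → q ∣ m → q ≠ 2 → J(-(N : ℤ) | q) = 1 ∧ ¬ q ∣ f :=
      fun q hq hqm hq2 ↦ (jacobiSym_neg_mul_sq_eq_one_iff hq N f).mp (hJ q hq hqm hq2)
    refine ⟨⟨h4, h8, fun q hq hqm hq2 ↦ (hJ' q hq hqm hq2).1, h3.1⟩, ?_⟩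
    -- `f ⊥ 6m`: no prime of `6m` divides `f`
    refine Nat.Coprime.symm (Nat.coprime_of_dvd fun q hq hq6m hqf ↦ ?_)
    rcases (Nat.Prime.dvd_mul hq).mp hq6m with hq6 | hqm
    · have hq23 : q = 2 ∨ q = 3 := by
        have : q ∣ 2 * 3 := hq6
        rcases (Nat.Prime.dvd_mul hq).mp this with h | h
        · exact Or.inl ((Nat.prime_dvd_prime_iff_eq hq Nat.prime_two).mp h)
        · exact Or.inr ((Nat.prime_dvd_prime_iff_eq hq Nat.prime_three).mp h)
      rcases hq23 with rfl | rfl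
      · exact hodd.not_two_dvd_nat hqf
      · exact h3.2 hqf
    · by_cases hq2 : q = 2
      · subst hq2
        exact hodd.not_two_dvd_nat hqf
      · exact (hJ' q hq hqm hq2).2 hqf
  · rintro ⟨⟨h4, h8, hJ, h3⟩, hcop⟩
    have hodd : Odd f := by
      refine Nat.odd_iff.mpr (Nat.two_dvd_ne_zero.mp fun h2 ↦ ?_)
      have : 2 ∣ Nat.gcd f (6 * m) := Nat.dvd_gcd h2 ⟨3 * m, by ring⟩
      rw [hcop] at this
      exact absurd this (by norm_num)
    have hqf : ∀ q : ℕ, q.Prime → q ∣ m → ¬ q ∣ f := by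
      intro q hq hqm hqf
      have : q ∣ Nat.gcd f (6 * m) := Nat.dvd_gcd hqf (Dvd.dvd.mul_left hqm 6)
      rw [hcop] at this
      exact hq.one_lt.ne' (Nat.dvd_one.mp this)
    have h3f : ¬ 3 ∣ f := by
      intro h3f
      have : 3 ∣ Nat.gcd f (6 * m) := Nat.dvd_gcd h3f ⟨2 * m, by ring⟩
      rw [hcop] at this
      exact absurd this (by norm_num)
    refine ⟨dvd_mul_right m _, by rwa [mul_sq_mod_four_of_odd N hodd], fun q hq hqm hq2 ↦ ?_,
      by rwa [mul_sq_mod_eight_of_odd N hodd], (not_three_dvd_mul_sq_iff N f).mpr ⟨h3, h3f⟩⟩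
    exact (jacobiSym_neg_mul_sq_eq_one_iff hq N f).mpr ⟨hJ q hq hqm hq2, hqf q hq hqm⟩


/-! ## §3 Re-indexing a sum over the cut along `a = m · N · f²` -/

/-- **Re-indexing over the cut.** For `m ≥ 1` and any `g : ℕ → ℂ`, the sum of `g` over the indices `a` of the (3,0)-`m`-cut equals
the sum of `g(m N f²)` over the pairs `(N, f)` with `N` in the family (squarefree, `≡ 3 (mod 4)`, `≡ 7 (mod 8)` if `2 ∣ m`,
`J(−N|q) = 1` for odd primes `q ∣ m`, `3 ∤ N`) and `f ⊥ 6m` — the map `(N, f) ↦ m N f²` being a bijection onto the cut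
(`cut_mul_sq_iff`, `eq_of_squarefree_mul_sq_eq`, `Nat.sq_mul_squarefree_of_pos`). Unconditional (both sides are `tsum`s).
[folklore] -/
theorem tsum_ite_cut_eq_tsum_prod {m : ℕ} (hm : m ≠ 0) (g : ℕ → ℂ) :
    ∑' a : ℕ, (if m ∣ a ∧ a / m % 4 = 3 ∧ (∀ q : ℕ, q.Prime → q ∣ m → q ≠ 2 → J(-((a / m : ℕ) : ℤ) | q) = 1) ∧
        (2 ∣ m → a / m % 8 = 7) ∧ ¬ 3 ∣ a / m then g a else 0) =
      ∑' x : ℕ × ℕ, (if (Squarefree x.1 ∧ x.1 % 4 = 3 ∧ (2 ∣ m → x.1 % 8 = 7) ∧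
          (∀ q : ℕ, q.Prime → q ∣ m → q ≠ 2 → J(-(x.1 : ℤ) | q) = 1) ∧ ¬ 3 ∣ x.1) ∧ x.2.Coprime (6 * m)
        then g (m * (x.1 * x.2 ^ 2)) else 0) := by
  classical
  set F : ℕ → ℂ := fun a ↦ if m ∣ a ∧ a / m % 4 = 3 ∧ (∀ q : ℕ, q.Prime → q ∣ m → q ≠ 2 → J(-((a / m : ℕ) : ℤ) | q) = 1) ∧
        (2 ∣ m → a / m % 8 = 7) ∧ ¬ 3 ∣ a / m then g a else 0 with hF
  set G : ℕ × ℕ → ℂ := fun x ↦ if (Squarefree x.1 ∧ x.1 % 4 = 3 ∧ (2 ∣ m → x.1 % 8 = 7) ∧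
          (∀ q : ℕ, q.Prime → q ∣ m → q ≠ 2 → J(-(x.1 : ℤ) | q) = 1) ∧ ¬ 3 ∣ x.1) ∧ x.2.Coprime (6 * m)
        then g (m * (x.1 * x.2 ^ 2)) else 0 with hG
  -- the value of `F` on the image of a good pair
  have hFG : ∀ N f : ℕ, (Squarefree N ∧ N % 4 = 3 ∧ (2 ∣ m → N % 8 = 7) ∧
      (∀ q : ℕ, q.Prime → q ∣ m → q ≠ 2 → J(-(N : ℤ) | q) = 1) ∧ ¬ 3 ∣ N) → f.Coprime (6 * m) →
      F (m * (N * f ^ 2)) = g (m * (N * f ^ 2)) := by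
    intro N f hN hf
    have hcut := (cut_mul_sq_iff hm N f).mpr ⟨⟨hN.2.1, hN.2.2.1, hN.2.2.2.1, hN.2.2.2.2⟩, hf⟩
    simp only [hF]
    rw [if_pos hcut]
  have hf0 : ∀ {f : ℕ}, f.Coprime (6 * m) → f ≠ 0 := by
    intro f hf h0
    rw [h0, Nat.coprime_zero_left] at hf
    omega
  refine (tsum_eq_tsum_of_ne_zero_bij (fun x : Function.support G ↦ m * (x.1.1 * x.1.2 ^ 2)) ?_ ?_ ?_).symm
    |>.symm
  · -- injectivity on the support
    rintro ⟨⟨N, f⟩, hx⟩ ⟨⟨N', f'⟩, hy⟩ h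
    simp only [Function.mem_support, hG, ne_eq, ite_eq_right_iff, Classical.not_imp] at hx hy
    simp only at h
    have h' : N * f ^ 2 = N' * f' ^ 2 := Nat.eq_of_mul_eq_mul_left (Nat.pos_of_ne_zero hm) h
    obtain ⟨h1, h2⟩ := eq_of_squarefree_mul_sq_eq hx.1.1.1 hy.1.1.1 (hf0 hx.1.2) (hf0 hy.1.2) h'
    subst h1 h2
    rfl
  · -- the support of `F` is covered
    intro a ha
    rw [Function.mem_support] at ha
    have hcut : m ∣ a ∧ a / m % 4 = 3 ∧ (∀ q : ℕ, q.Prime → q ∣ m → q ≠ 2 → J(-((a / m : ℕ) : ℤ) | q) = 1) ∧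
        (2 ∣ m → a / m % 8 = 7) ∧ ¬ 3 ∣ a / m := by
      by_contra h
      exact ha (if_neg h)
    obtain ⟨n', rfl⟩ := hcut.1
    have h4 := hcut.2.1
    have hn' : 0 < n' := by
      rw [Nat.mul_div_cancel_left _ (Nat.pos_of_ne_zero hm)] at h4
      omega
    obtain ⟨N, f, -, hf, hNf, hN⟩ := Nat.sq_mul_squarefree_of_pos hn'
    have ha' : m * n' = m * (N * f ^ 2) := by rw [← hNf]; ring
    rw [ha'] at hcut ha
    obtain ⟨hfam, hcop⟩ := (cut_mul_sq_iff hm N f).mp hcut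
    have hGx : G (N, f) ≠ 0 := by
      simp only [hG]
      rw [if_pos ⟨⟨hN, hfam⟩, hcop⟩]
      rw [if_pos hcut] at ha
      exact ha
    exact ⟨⟨(N, f), hGx⟩, by simp only [ha']⟩
  · -- values agree
    rintro ⟨⟨N, f⟩, hx⟩
    have hx' := hx
    simp only [Function.mem_support, hG, ne_eq, ite_eq_right_iff, Classical.not_imp] at hx'
    simp only [hG]
    rw [if_pos hx'.1]
    exact hFG N f hx'.1.1 hx'.1.2


/-- **Summability transfers along the re-indexing** (same bijection as `tsum_ite_cut_eq_tsum_prod`). [folklore] -/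
theorem summable_ite_cut_iff_summable_prod {m : ℕ} (hm : m ≠ 0) (g : ℕ → ℂ) :
    Summable (fun a : ℕ ↦ if m ∣ a ∧ a / m % 4 = 3 ∧ (∀ q : ℕ, q.Prime → q ∣ m → q ≠ 2 → J(-((a / m : ℕ) : ℤ) | q) = 1) ∧
        (2 ∣ m → a / m % 8 = 7) ∧ ¬ 3 ∣ a / m then g a else 0) ↔
      Summable (fun x : ℕ × ℕ ↦ if (Squarefree x.1 ∧ x.1 % 4 = 3 ∧ (2 ∣ m → x.1 % 8 = 7) ∧
          (∀ q : ℕ, q.Prime → q ∣ m → q ≠ 2 → J(-(x.1 : ℤ) | q) = 1) ∧ ¬ 3 ∣ x.1) ∧ x.2.Coprime (6 * m)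
        then g (m * (x.1 * x.2 ^ 2)) else 0) := by
  classical
  set F : ℕ → ℂ := fun a ↦ if m ∣ a ∧ a / m % 4 = 3 ∧ (∀ q : ℕ, q.Prime → q ∣ m → q ≠ 2 → J(-((a / m : ℕ) : ℤ) | q) = 1) ∧
        (2 ∣ m → a / m % 8 = 7) ∧ ¬ 3 ∣ a / m then g a else 0 with hF
  set G : ℕ × ℕ → ℂ := fun x ↦ if (Squarefree x.1 ∧ x.1 % 4 = 3 ∧ (2 ∣ m → x.1 % 8 = 7) ∧
          (∀ q : ℕ, q.Prime → q ∣ m → q ≠ 2 → J(-(x.1 : ℤ) | q) = 1) ∧ ¬ 3 ∣ x.1) ∧ x.2.Coprime (6 * m)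
        then g (m * (x.1 * x.2 ^ 2)) else 0 with hG
  have hf0 : ∀ {f : ℕ}, f.Coprime (6 * m) → f ≠ 0 := by
    intro f hf h0
    rw [h0, Nat.coprime_zero_left] at hf
    omega
  -- the map `(N, f) ↦ m N f²` from `support G` to `support F`
  have hval : ∀ x : Function.support G, F (m * (x.1.1 * x.1.2 ^ 2)) = G x.1 ∧ m * (x.1.1 * x.1.2 ^ 2) ∈ Function.support F := by
    rintro ⟨⟨N, f⟩, hx⟩
    have hx' := hx
    simp only [Function.mem_support, hG, ne_eq, ite_eq_right_iff, Classical.not_imp] at hx'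
    have hcut := (cut_mul_sq_iff hm N f).mpr ⟨⟨hx'.1.1.2.1, hx'.1.1.2.2.1, hx'.1.1.2.2.2.1, hx'.1.1.2.2.2.2⟩, hx'.1.2⟩
    have h1 : F (m * (N * f ^ 2)) = G (N, f) := by
      simp only [hF, hG]
      rw [if_pos hcut, if_pos hx'.1]
    exact ⟨h1, by rw [Function.mem_support, h1]; exact hx⟩
  let φ : Function.support G → Function.support F := fun x ↦ ⟨m * (x.1.1 * x.1.2 ^ 2), (hval x).2⟩
  have hφ : Function.Bijective φ := by
    constructor
    · rintro ⟨⟨N, f⟩, hx⟩ ⟨⟨N', f'⟩, hy⟩ h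
      simp only [φ, Subtype.mk.injEq] at h
      simp only [Function.mem_support, hG, ne_eq, ite_eq_right_iff, Classical.not_imp] at hx hy
      have h' : N * f ^ 2 = N' * f' ^ 2 := Nat.eq_of_mul_eq_mul_left (Nat.pos_of_ne_zero hm) h
      obtain ⟨h1, h2⟩ := eq_of_squarefree_mul_sq_eq hx.1.1.1 hy.1.1.1 (hf0 hx.1.2) (hf0 hy.1.2) h'
      subst h1 h2
      rfl
    · rintro ⟨a, ha⟩
      rw [Function.mem_support] at ha
      have hcut : m ∣ a ∧ a / m % 4 = 3 ∧ (∀ q : ℕ, q.Prime → q ∣ m → q ≠ 2 → J(-((a / m : ℕ) : ℤ) | q) = 1) ∧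
          (2 ∣ m → a / m % 8 = 7) ∧ ¬ 3 ∣ a / m := by
        by_contra h
        exact ha (if_neg h)
      obtain ⟨n', rfl⟩ := hcut.1
      have h4 := hcut.2.1
      have hn' : 0 < n' := by
        rw [Nat.mul_div_cancel_left _ (Nat.pos_of_ne_zero hm)] at h4
        omega
      obtain ⟨N, f, -, hf, hNf, hN⟩ := Nat.sq_mul_squarefree_of_pos hn'
      have ha' : m * n' = m * (N * f ^ 2) := by rw [← hNf]; ring
      rw [ha'] at hcut ha
      obtain ⟨hfam, hcop⟩ := (cut_mul_sq_iff hm N f).mp hcut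
      have hGx : G (N, f) ≠ 0 := by
        have h1 : F (m * (N * f ^ 2)) = G (N, f) := by
          simp only [hF, hG]
          rw [if_pos hcut, if_pos ⟨⟨hN, hfam⟩, hcop⟩]
        rw [← h1]
        exact ha
      exact ⟨⟨(N, f), hGx⟩, Subtype.ext (by simp only [φ, ha'])⟩
  exact (Equiv.summable_iff_of_support (Equiv.ofBijective φ hφ).symm fun x ↦ by
    obtain ⟨y, rfl⟩ := hφ.2 x
    rw [Equiv.ofBijective_symm_apply_apply]
    exact (hval y).1.symm)

end Summit.BirchSwinnertonDyer.BirchSwinnertonDyer.Theorems.PrintCFram.CuspSeed
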